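import Literature.Claims.NS.ClayR3EnstrophyBridge
import HarnessLib

/-!
# Claim skeleton (D-0090 NS-CLAIMS, C169): Sarici, «A Geometric Framework for the Global Regularity of
# the 3D Navier–Stokes Equations via Intrinsic Topological Back-Reaction» (Zenodo 19312090, «Revised V4», 2026, 45 pp.)

Typed CHAIN-LEVEL skeleton (QUICK row, pp. 4–6) of E. Sarici, *A Geometric Framework for the Global
Regularity of the 3D Navier–Stokes Equations via Intrinsic Topological Back-Reaction*, Zenodo record
**19312090** (latest, `is_last`, of concept 18117929; printed «Date: March 8, 2026 (Revised V4)»; PDF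
sha16 `ae2d84b919a0af1a`, 45 pp.; PDF page = printed page = file `census/texts/Sarici2026/pages/pNNN.txt`,
line numbers below are the lines of those files). Numbered C169 by RULINGS v1.44 (ns-claims-lead-1 g7,
2026-08-27T15:24:38Z). Citations in the text print as «[?]»; §1 is printed twice; the roadmap's section
numbers are off by one — every locator is PAGE + LINE.

## Setting and claimed statement
Unforced incompressible Navier–Stokes on `ℝ³` with viscosity `ν > 0` (p.1 l.17, p.4 l.16–20, (5.1) p.5).
CLAIMED (REG): p.2 l.29–33 «The main result of this paper is the establishment of a time-independent a
priori bound for the H^m norms of the velocity field, provided the initial data satisfies u0 ∈ V. This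
deterministic bound guarantees that the enstrophy, along with all higher-order derivatives, cannot blow
up in finite time, thereby ensuring global-in-time strong solutions»; abstract p.1 l.7–15 «we establish
the global regularity of the three-dimensional incompressible Navier-Stokes equations … Leray-Hopf weak
solutions remain globally smooth, unique, and are asymptotically confined to a finite-dimensional global
attractor» (uniqueness and the attractor are EXTRA faces, not used by Thm 6.1 — recorded, not typed).
Displayed core: **Theorem 6.1 (Global A Priori Bound) p.6 l.49–59** «Let u0 ∈ V ∩ H^s(ℝ³) for s ≥ 3.
Under the spectral topological cutoff condition q > Jmax derived from Lemma 5.1, the solution satisfies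
(6.4) sup_{t∈[0,T]} ‖u(t)‖²_{H^s} ≤ C(u0, ν), where C(u0, ν) is a strictly time-independent universal
constant» — PRINTED CONDITIONAL on «q > Jmax», where `q` is a dyadic index that occurs nowhere in (6.4)
and `Jmax` is «the topological capacity limit defined by the Euler characteristic χ(M⁴)» (Lemma 14.1
p.18 l.38–39; first named p.2 l.23 «a strictly determined critical threshold», p.5 l.53): typed AS
PRINTED as a leading binder `∀ q, Jmax < q →` of `Step_Thm61`, and `step_Thm61_iff_unconditional`
PROVES that it binds nothing.

## Vocabulary (how the print's objects are rendered)
* Data `IsDatum` = Fefferman's class (4) EXACTLY (C^∞, divergence-free, rapid decay of all derivatives).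
  The print's data class «u0 ∈ V ∩ H^s(ℝ³), s ≥ 3» / «u0 ∈ V» ((3.2) p.3: `V` = H¹-closure of smooth
  compactly supported divergence-free fields) is WIDER — every typed statement is the printed one
  INSTANTIATED on the narrower class (weaker, never stronger); the Δ-data axis is recorded on the CARD.
* Solutions `IsSol ν T u₀ u p` = the finite-energy classical solutions of the unforced system on the
  half-open slab `[0,T) × ℝ³` from `u₀` (the class of the tree's Beale–Kato–Majda door
  `clayR3_regularityAt_iff_aprioriBKM` and enstrophy/`H¹` door `clayR3_regularityAt_iff_aprioriGradientL2Bound`);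
  the print's «the solution» (Thm 6.1) / «Leray-Hopf weak solutions … promoted to strong solutions»
  (p.6 l.97–98) instantiated on it.
* `hDotSq n v = ∫ ‖Dⁿv‖²` (the `Ḣⁿ` seminorm squared of (6.1)–(6.7)), `hSq m v = Σ_{n ≤ m} ∫ ‖Dⁿv‖²`
  (the `H^m` norm squared of (6.4); (3.1) p.3 defines `H^s` on the Fourier side with weight
  `(1+|ξ|²)^s` — for integer `s` the same norm up to a constant, absorbed by the unspecified `C(u0, ν)`;
  TODO(general form): real `s ≥ 3`), `gradSup v = sup_x ‖∇v(x)‖` (`‖∇u‖_{L∞}`).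
* The print's Littlewood–Paley / Calderón–Zygmund gadgets (pp. 3–5: blocks `Δ_j` (3.4), the Riesz
  products `R_iR_j` (4.1), Bony's remainder `R(ω, ∇u)` (3.6)/(5.2), the threshold `Jmax`) are NOT in the
  tree: they enter as an explicit `LPKit` of named DATA (posits with their printed definitions recorded in
  the field docstrings — posits are not steps; RULINGS 11:21Z (1) pattern of `Cox2025.CarlemanKit`), an
  explicit argument of every step that mentions them. A refutation that lives off a degenerate kit falls
  under the DEGENERATE-WITNESS rule (RULINGS v1.41).

## The printed chain (RULINGS v1.44 (1); binder order of `claim_of_steps`) and how it is typed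
1. `Step_L41 K` — Lemma 4.1 (4.2) p.4 l.31–37 «‖[R_iR_j, u·∇]f‖_{L²} ≤ C‖∇u‖_{L∞}‖f‖_{L²}, C universal»,
   function grain over the kit's `R_iR_j` (TRUE-type: Calderón's first commutator estimate; not re-proved).
2. `Step_L51 K` — Lemma 5.1 (5.3) p.5 l.28–36 «‖Δ_q R(ω, ∇u)‖_{L²} ≤ C 2^q Σ_{j ≥ q−N} ‖Δ_jω‖_{L²}
   ‖Δ̃_j∇u‖_{L²}», function grain VERBATIM over the kit (typist's private flag: the printed proof's own
   Bernstein exponent p.5 l.45–51 is `2^{3q(1/r−1/p)} = 2^{3q/2}` for `r = 1, p = 2`, not `2^q`).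
3. `Step_dominance K ν` — the PROSE step p.5 l.52–56 «by combining Lemma 4.1 and Lemma 5.1, we can
   definitively show that for wave numbers q > Jmax (the topological cutoff), the nonlinear injection of
   enstrophy is strictly dominated by the viscous dissipation ν‖∇Δ_qω‖²_{L²}», at the grain of (5.1) (the
   block enstrophy balance ALONG THE SOLUTION): for every solution, every time, every `q > Jmax`, the block
   enstrophy production `⟨Δ_q(ω·∇u), Δ_qω⟩ ≤ ν‖∇Δ_qω‖²`; its printed justification is typed as the
   implication the sentence asserts, `Step_dominance_of K ν : Step_L41 K → Step_L51 K → Step_dominance K ν`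
   (no display derives it — RULINGS (h2)).
4. `Step_65 ν s` — (6.5) p.6 l.60–70, the Kato–Ponce `Ḣ^s` energy inequality along the solution
   (TRUE-type classical bookkeeping, (6.1)–(6.3)).
5. `Step_66 ν` — **(6.6) p.6 l.71–82 «∫₀ᵀ ‖∇u(τ)‖_{L∞} dτ ≤ C∗ < ∞, where C∗ is a deterministically
   defined constant»**, for every solution of the class from the datum and every `T`, `C∗` independent of
   `T` (it is exponentiated into the «strictly time-independent» constant of (6.4) at l.92–96) — an a
   priori Beale–Kato–Majda majorant, hence (A)-strength by itself: `clayA_of_step66` PROVED; its printed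
   justification l.71–75 («From [Lemma 4.1] and [the Bony paraproducts] the enstrophy production is
   strictly suppressed above the critical wave number. Therefore …») is typed as the implication it
   asserts, `Step_66_of K ν : Step_dominance K ν → Step_66 ν`.
6. `Step_67 ν s` — (6.7) p.6 l.82–95 first inequality (Grönwall: `‖u(t)‖²_{Ḣ^s} ≤ ‖u0‖²_{Ḣ^s}
   exp(C ∫₀ᵗ ‖∇u‖_{L∞})`), TRUE-type; the passage «Applying the classical Gronwall's inequality yields»
   is `Step_67_of ν s : Step_65 ν s → Step_67 ν s`.
7. `Step_Thm61 K ν s` — Theorem 6.1 (6.4) p.6 l.49–59 with its printed condition «q > Jmax» as the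
   leading binder; the passage l.92–96 (second inequality of (6.7), «≤ ‖u0‖² exp(CC∗)», «time-independent»)
   is `Step_Thm61_of K ν s : Step_66 ν → Step_67 ν s → Step_Thm61 K ν s`.
8. `ClaimedTheorem ν` — p.6 l.96–99 / p.2 l.29–33: the a priori `H^s` bound ⇒ global strong (Clay-sense)
   solutions: `claim_of_thm61` PROVED by the tree's `H¹` door (an `H^s` bound with `s ≥ 1` bounds
   `∫‖∇u(t)‖²` on `[0,T)`).

COMPOSITION — PROVED, every binder consumed:
`claim_of_steps K hν hs : Step_L41 K → Step_L51 K → Step_dominance_of K ν → Step_65 ν s → Step_66_of K ν →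
Step_67_of ν s → Step_Thm61_of K ν s → ClaimedTheorem ν`; `claimedTheorem_iff_clayA : ClaimedTheorem ν ↔
clayR3.Regularity` (the claim as typed IS Clay (A); no «wrong problem» axis on the (A) side);
`clayA_of_step66` ((6.6) alone is (A)); `step_Thm61_iff_unconditional` («q > Jmax» binds nothing).
Where the print displays NO derivation (records, not verdicts): `Step_dominance_of` (p.5 l.52–56) and
`Step_66_of` (p.6 l.71–75) — the two «therefore»s between the harmonic-analysis lemmas and the a priori
BKM law; every displayed estimate upstream of (6.6) is a Fourier-multiplier / paraproduct / Kato–Ponce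
statement (AVERAGED axis, keeper's call). Not typed (recorded): (6.1)–(6.3) p.6 (inside (6.5)); (5.1)–(5.2)
p.5 (the block balance — its production and dissipation terms are the objects of `Step_dominance`); §3
pp. 3–4 definitions (in the kit docstrings); pp. 7–45 (wrapping operator, «Perelman-type monotonicity»,
curved space-time, Lemma 14.1) — out of scope except the NAME `Jmax`: the pp. 1–6 chain imports no
display from them by number («Section 3» / «Section 4» = Lemma 4.1 / Lemma 5.1 by the off-by-one
numbering), and the items `sources/Sarici2026/LOCATORS.md` v2.1 (960b7c5a45ac8d6e) §1 (cont.) tabulates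
(Lemma 9.1, Thm 11.1, Lemma 14.1, Thm 15.1, Thm 21.1, Thms 23.5–23.6, Thm 24.1) are all conditioned on
the text's own construction (`F_Ω`, `M⁴`); the abstract's uniqueness and attractor faces.

## References
* E. Sarici, *A Geometric Framework for the Global Regularity of the 3D Navier–Stokes Equations via
  Intrinsic Topological Back-Reaction*, Zenodo record 19312090 («Revised V4», 2026), 45 pp. [Sarici2026]
* C. L. Fefferman, *Existence and smoothness of the Navier–Stokes equation*, CMI 2006, (A) with (4)–(7)
  p. 2. [FeffermanClay2006]
* J. T. Beale, T. Kato, A. Majda, Comm. Math. Phys. 94 (1984), Thm. 1. [BealeKatoMajda1984]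

WHAT THIS IS NOT: not a claim about NS regularity or blow-up; not a claim about any author beyond the
typed locator.
-/

open scoped ContDiff ENNReal NNReal Topology RealInnerProductSpace
open Set Filter MeasureTheory Function

namespace Literature.Claims.NS.Sarici2026

open Literature.Analysis Literature.Analysis.FluidPDE Literature.Claims.NS.ClayVariants

noncomputable section

/-! ## Vocabulary -/

/-- `ℝ³`. [cite: Sarici2026, §3.1 p.3 l.7–17] -/
abbrev E3 : Type := EuclideanSpace ℝ (Fin 3)

/-- **The data class the chain is consumed on**: C^∞, divergence-free, rapid decay of every derivative —
Fefferman's (4) EXACTLY. The print's «u0 ∈ V ∩ H^s(ℝ³) for s ≥ 3» (Thm 6.1 p.6 l.49–51; `V` = (3.2) p.3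
l.36–53) is WIDER (recorded). [cite: Sarici2026, Thm 6.1 p.6 l.49–51; (3.2) p.3 l.36–53]
[cite: FeffermanClay2006, (4) p. 1] -/
def IsDatum (u₀ : E3 → E3) : Prop :=
  ContDiff ℝ ∞ u₀ ∧ NSWave0.IsDivFree u₀ ∧ HasRapidSpatialDecay u₀

/-- **The solutions the chain is consumed on**: a classical solution of the unforced system with
viscosity `ν` on the half-open slab `[0,T) × ℝ³` with `u(0) = u₀` and a finite bound on the kinetic
energy over `[0,T)` (the class of the tree's BKM / `H¹` doors). The print's «the solution» / «Leray-Hopf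
weak solutions … promoted to strong solutions» (p.6 l.53, l.97–98) instantiated on it.
[cite: Sarici2026, Thm 6.1 p.6 l.49–59; p.6 l.96–99] [cite: FeffermanClay2006, (6) (7) p. 2] -/
def IsSol (ν T : ℝ) (u₀ : E3 → E3) (u : ℝ → E3 → E3) (p : ℝ → E3 → ℝ) : Prop :=
  IsClassicalNSSolutionOn (Ico 0 T) ν 0 u p ∧ u 0 = u₀ ∧
    ∃ A : ℝ≥0∞, A < ⊤ ∧ ∀ t ∈ Ico 0 T, ∫⁻ x, ‖u t x‖ₑ ^ 2 ≤ A

/-- The homogeneous Sobolev seminorm squared `‖v‖²_{Ḣⁿ} = ∫ ‖Dⁿ v‖²` (integer `n`; (6.1)–(6.7) p.6).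
`ℝ≥0∞`-valued. [cite: Sarici2026, (3.1) p.3 l.18–34; (6.1) p.6 l.7–17] -/
def hDotSq (n : ℕ) (v : E3 → E3) : ℝ≥0∞ := ∫⁻ x, ‖iteratedFDeriv ℝ n v x‖ₑ ^ 2

/-- The inhomogeneous Sobolev norm squared `‖v‖²_{H^m} = Σ_{n ≤ m} ∫ ‖Dⁿ v‖²` (integer `m`; the norm of
(6.4); (3.1) p.3 is the Fourier-side definition — the same norm up to a constant for integer `s`).
TODO(general form): real `s`. [cite: Sarici2026, (3.1) p.3 l.18–34; (6.4) p.6 l.54–58] -/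
def hSq (m : ℕ) (v : E3 → E3) : ℝ≥0∞ := ∑ n ∈ Finset.range (m + 1), hDotSq n v

/-- `‖∇v‖_{L∞} = sup_x ‖Dv(x)‖` (operator norm), `ℝ≥0∞`-valued. [cite: Sarici2026, (6.5)–(6.6) p.6 l.62–82] -/
def gradSup (v : E3 → E3) : ℝ≥0∞ := ⨆ x, ‖fderiv ℝ v x‖ₑ

/-- The vortex-stretching field `(ω·∇)u` with `ω = curl u` (p.5 l.12 «ω · ∇u, where ω = ∇ × u is the
vorticity»): `x ↦ Du(x)[ω(x)]`. [cite: Sarici2026, §5 p.5 l.11–15] -/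
def stretching (v : E3 → E3) : E3 → E3 := convect (curl v) v

/-- **The print's Littlewood–Paley / Calderón–Zygmund gadgets, as named DATA** (not in the tree; posits,
not steps — every step that mentions them takes the kit as an explicit argument). Their printed
definitions are recorded field by field. [cite: Sarici2026, §3.2–3.3 pp. 3–4; (4.1) p.4 l.19–20; p.5 l.53; Lemma 14.1 p.18 l.38–39] -/
structure LPKit where
  /-- the Littlewood–Paley block `Δ_j` acting (componentwise) on vector fields: (3.4) p.3 l.73–90
  «Δ_j f = F⁻¹(φ(2^{−j}ξ) f̂(ξ)), Δ_{−1} f = F⁻¹(χ(ξ) f̂(ξ))», `Δ_j = 0` for `j < −1`, with the dyadic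
  partition (3.3) «χ(ξ) + Σ_{j≥0} φ(2^{−j}ξ) = 1», `χ ∈ C_c^∞(B)`, `φ ∈ C_c^∞(C)`,
  `C = {3/4 ≤ |ξ| ≤ 8/3}`, `B = {|ξ| ≤ 4/3}`. -/
  block : ℤ → (E3 → E3) → (E3 → E3)
  /-- the Riesz product `R_iR_j`, `R_i = ∂_i(−Δ)^{−1/2}`, acting on scalar functions: (4.1) p.4 l.19–20. -/
  riesz2 : Fin 3 → Fin 3 → (E3 → ℝ) → (E3 → ℝ)
  /-- Bony's remainder part of the stretching term, `u ↦ R(ω, ∇u) = Σ_{|j−j'|≤1} (Δ_jω·∇)Δ_{j'}u`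
  ((3.6) p.4 l.5–12 «R(u, v) = Σ_{|j−j'|≤1} Δ_ju Δ_{j'}v is the remainder»; (5.2) p.5 l.27), as a field. -/
  remainder : (E3 → E3) → (E3 → E3)
  /-- the threshold `Jmax`: p.2 l.23 «a strictly determined critical threshold, denoted as Jmax», p.5 l.53
  «(the topological cutoff)», Lemma 14.1 p.18 l.38–39 «the topological capacity limit defined by the Euler
  characteristic χ(M⁴)» — a number; no dependence on the datum, `ν` or time is printed. -/
  Jmax : ℤ

/-- `Δ̃_j = Δ_{j−1} + Δ_j + Δ_{j+1}` (Lemma 5.1 p.5 l.35–36). [cite: Sarici2026, Lemma 5.1 p.5 l.35–36] -/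
def LPKit.blockTilde (K : LPKit) (j : ℤ) (v : E3 → E3) : E3 → E3 :=
  fun x => K.block (j - 1) v x + K.block j v x + K.block (j + 1) v x

/-- The block enstrophy PRODUCTION `⟨Δ_q(ω·∇u), Δ_qω⟩_{L²}` of the balance (5.1) p.5 l.13–24 tested with
`Δ_qω` («Taking the L² inner product with Δ_qω»; the transport term vanishes, l.18–24) — the «nonlinear
injection of enstrophy» / «enstrophy production» of p.5 l.53–54 / p.6 l.72–73. Real Bochner integral
(junk `0` off integrability, never used there by the chain). [cite: Sarici2026, (5.1) p.5 l.13–24; p.5 l.52–56] -/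
def LPKit.blockProduction (K : LPKit) (q : ℤ) (v : E3 → E3) : ℝ :=
  ∫ x, ⟪K.block q (stretching v) x, K.block q (curl v) x⟫

/-- The block viscous DISSIPATION `ν ‖∇Δ_qω‖²_{L²}` of (5.1) (p.5 l.54–56). `ℝ≥0∞`-valued.
[cite: Sarici2026, (5.1) p.5 l.13–15; p.5 l.53–56] -/
def LPKit.blockDissipation (K : LPKit) (ν : ℝ) (q : ℤ) (v : E3 → E3) : ℝ≥0∞ :=
  ENNReal.ofReal ν * ∫⁻ x, ‖fderiv ℝ (K.block q (curl v)) x‖ₑ ^ 2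

/-! ## The claimed statement -/

/-- **CLAIMED THEOREM — the REG face p.2 l.29–33 / abstract p.1 l.7–13 on the data class (4) at the
print's fixed viscosity `ν`**: every Clay datum launches a global smooth solution with bounded energy
(`clayR3.Solvable ν 0 u₀`: `u, p ∈ C^∞(ℝ³ × [0,∞))`, (1)–(3), (7)) — «ensuring global-in-time strong
solutions», «remain globally regular … for all t > 0» (p.6 l.98–99). The abstract's uniqueness and
finite-dimensional-attractor faces are recorded in the module docstring, not typed.
[claim: Sarici2026, status: under-review] [cite: Sarici2026, p.2 l.29–33; abstract p.1 l.7–15; p.6 l.96–99] -/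
def ClaimedTheorem (ν : ℝ) : Prop :=
  ∀ u₀ : E3 → E3, IsDatum u₀ → clayR3.Solvable ν 0 u₀

/-! ## The steps of the printed chain (no assertion) -/

/-- **Step 1 — Lemma 4.1 (Pressure Hessian Commutator Bound), (4.2) p.4 l.31–37**: «Let u ∈ V ∩ H^s(ℝ³)
with s > 5/2. For any smooth test function f, the commutator [R_iR_j, u·∇]f = R_iR_j(u·∇f) − u·∇(R_iR_jf)
satisfies the bound (4.2) ‖[R_iR_j, u·∇]f‖_{L²} ≤ C‖∇u‖_{L∞}‖f‖_{L²}, where C > 0 is a universal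
constant independent of u and f.» Typed over the kit's `R_iR_j`, for fields of the data class (narrower
than `V ∩ H^s`, s > 5/2) and smooth compactly supported `f` (so that `‖f‖_{L²} < ∞`). TRUE-type
(Calderón's first commutator estimate); not re-proved. [claim: Sarici2026, status: under-review]
[cite: Sarici2026, Lemma 4.1 (4.2) p.4 l.31–37] -/
def Step_L41 (K : LPKit) : Prop :=
  ∃ C : ℝ≥0, ∀ u : E3 → E3, IsDatum u →
    ∀ f : E3 → ℝ, ContDiff ℝ ∞ f → HasCompactSupport f → ∀ i j : Fin 3,
      eLpNorm (fun x => K.riesz2 i j (fun y => fderiv ℝ f y (u y)) x - fderiv ℝ (K.riesz2 i j f) x (u x))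
          2 volume ≤
        (C : ℝ≥0∞) * gradSup u * eLpNorm f 2 volume

/-- **Step 2 — Lemma 5.1 (Bernstein Estimates for the Nonlinear Term), (5.3) p.5 l.28–36**, VERBATIM
over the kit: «For any q ≥ 0, the paraproduct remainder satisfies the strictly localized estimate
(5.3) ‖Δ_q R(ω, ∇u)‖_{L²} ≤ C 2^q Σ_{j ≥ q−N} ‖Δ_jω‖_{L²} ‖Δ̃_j∇u‖_{L²}, where Δ̃_j = Δ_{j−1} + Δ_j +
Δ_{j+1}» (`ω = curl u`, `Δ̃_j∇u = ∇Δ̃_ju`; `C`, `N` universal; for fields of the data class). Printed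
proof p.5 l.37–51 (Fourier support in a ball of radius `C2^j`, Bernstein «‖Δ_qf‖_{Lp} ≤
C2^{3q(1/r−1/p)}‖Δ_qf‖_{Lr} with r = 1, p = 2») recorded. [claim: Sarici2026, status: under-review]
[cite: Sarici2026, Lemma 5.1 (5.3) p.5 l.28–51] -/
def Step_L51 (K : LPKit) : Prop :=
  ∃ (C : ℝ≥0) (N : ℕ), ∀ u : E3 → E3, IsDatum u → ∀ q : ℤ, 0 ≤ q →
    eLpNorm (K.block q (K.remainder u)) 2 volume ≤
      (C : ℝ≥0∞) * (2 : ℝ≥0∞) ^ q *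
        ∑' j : {j : ℤ // q - N ≤ j},
          eLpNorm (K.block j.1 (curl u)) 2 volume *
            eLpNorm (fun x => fderiv ℝ (K.blockTilde j.1 u) x) 2 volume

/-- **Step 3 — the PROSE dominance step p.5 l.52–56**: «Crucially, by combining Lemma 4.1 and Lemma 5.1,
we can definitively show that for wave numbers q > Jmax (the topological cutoff), the nonlinear injection
of enstrophy is strictly dominated by the viscous dissipation ν‖∇Δ_qω‖²_{L²}.» At the grain of the block
balance (5.1) it refers to (the vorticity equation of THE SOLUTION localised by `Δ_q` and tested with
`Δ_qω`): along every solution of the class, at every time, for every `q > Jmax`, the block enstrophy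
production is at most the block dissipation («strictly» relaxed to `≤` — weaker). The commutator term
`[Δ_q, u·∇]ω` of (5.1) is left where the print leaves it (unestimated). No display derives this sentence;
its asserted derivation is `Step_dominance_of`. [claim: Sarici2026, status: under-review]
[cite: Sarici2026, p.5 l.52–56; (5.1) p.5 l.13–24] -/
def Step_dominance (K : LPKit) (ν : ℝ) : Prop :=
  ∀ (u₀ : E3 → E3) (T : ℝ) (u : ℝ → E3 → E3) (p : ℝ → E3 → ℝ), IsDatum u₀ → IsSol ν T u₀ u p →
    ∀ t ∈ Ico 0 T, ∀ q : ℤ, K.Jmax < q →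
      ENNReal.ofReal (K.blockProduction q (u t)) ≤ K.blockDissipation ν q (u t)

/-- **Step 3′ — the asserted derivation of the dominance step, p.5 l.52–53** «by combining Lemma 4.1 and
Lemma 5.1, we can definitively show that …»: typed as the implication the sentence asserts (undisplayed).
[claim: Sarici2026, status: under-review] [cite: Sarici2026, p.5 l.52–56] -/
def Step_dominance_of (K : LPKit) (ν : ℝ) : Prop :=
  Step_L41 K → Step_L51 K → Step_dominance K ν

/-- **Step 4 — (6.5) p.6 l.60–70, the Kato–Ponce `Ḣ^s` energy inequality**: «Inserting the Kato-Ponce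
commutator bound into the higher-order energy identity (6.1), we obtain the differential inequality
(6.5) d/dt ‖u‖²_{Ḣ^s} + 2ν‖u‖²_{Ḣ^{s+1}} ≤ C‖∇u‖_{L∞}‖u‖²_{Ḣ^s}» along the solution, `t ∈ (0,T)`
(the derivative is asserted to exist, as printed; `C = C(s)`). TRUE-type ((6.1)–(6.3): `Λ^s` energy
identity, pressure term vanishes, Kato–Ponce (6.2)). [claim: Sarici2026, status: under-review]
[cite: Sarici2026, (6.5) p.6 l.60–70; (6.1)–(6.3) p.6 l.2–48] -/
def Step_65 (ν : ℝ) (s : ℕ) : Prop :=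
  ∃ C : ℝ≥0, ∀ (u₀ : E3 → E3) (T : ℝ) (u : ℝ → E3 → E3) (p : ℝ → E3 → ℝ), IsDatum u₀ →
    IsSol ν T u₀ u p → ∀ t ∈ Ioo 0 T,
      DifferentiableAt ℝ (fun τ => (hDotSq s (u τ)).toReal) t ∧
        deriv (fun τ => (hDotSq s (u τ)).toReal) t + 2 * ν * (hDotSq (s + 1) (u t)).toReal ≤
          C * (gradSup (u t)).toReal * (hDotSq s (u t)).toReal

/-- **Step 5 — (6.6) p.6 l.71–82, the a priori Beale–Kato–Majda law**: «the Beale-Kato-Majda (BKM)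
criterion integral is universally bounded by our structural constraints: (6.6) ∫₀ᵀ ‖∇u(τ)‖_{L∞} dτ ≤
C∗ < ∞, where C∗ is a deterministically defined constant» — for every datum of the class a constant `C∗`
(allowed to depend on the datum and `ν`, as (6.4)'s `C(u0, ν)` into which it is exponentiated at l.92–96;
NOT on `T`: «strictly time-independent») bounding the integral along every solution from the datum on
every `[0,T)`. (A)-strength by itself (`clayA_of_step66`). Its printed justification l.71–75 is
`Step_66_of`. [claim: Sarici2026, status: under-review] [cite: Sarici2026, (6.6) p.6 l.76–82 with l.71–75] -/
def Step_66 (ν : ℝ) : Prop :=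
  ∀ u₀ : E3 → E3, IsDatum u₀ → ∃ Cstar : ℝ≥0,
    ∀ (T : ℝ) (u : ℝ → E3 → E3) (p : ℝ → E3 → ℝ), IsSol ν T u₀ u p →
      (∫⁻ t in Ioo 0 T, gradSup (u t)) ≤ Cstar

/-- **Step 5′ — the asserted derivation of (6.6), p.6 l.71–75**: «From the geometric self-orthogonalization
proven via the Calderón-Zygmund estimates in Section 3 and the Bony paraproducts in Section 4, the
enstrophy production is strictly suppressed above the critical wave number. Therefore, the Beale-Kato-Majda
(BKM) criterion integral is universally bounded»: typed as the implication the sentence asserts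
(dominance above `Jmax` ⇒ (6.6); undisplayed). [claim: Sarici2026, status: under-review]
[cite: Sarici2026, p.6 l.71–82] -/
def Step_66_of (K : LPKit) (ν : ℝ) : Prop :=
  Step_dominance K ν → Step_66 ν

/-- **Step 6 — (6.7) p.6 l.82–92, first inequality (Grönwall)**: «Applying the classical Gronwall's
inequality yields: (6.7) ‖u(t)‖²_{Ḣ^s} ≤ ‖u0‖²_{Ḣ^s} exp(C ∫₀ᵗ ‖∇u(τ)‖_{L∞} dτ)» along the solution,
`t ∈ [0,T)`, guarded to finite values of the time integral (where the print uses it, by (6.6)).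
TRUE-type (from (6.5)). [claim: Sarici2026, status: under-review] [cite: Sarici2026, (6.7) p.6 l.82–95] -/
def Step_67 (ν : ℝ) (s : ℕ) : Prop :=
  ∃ C : ℝ≥0, ∀ (u₀ : E3 → E3) (T : ℝ) (u : ℝ → E3 → E3) (p : ℝ → E3 → ℝ), IsDatum u₀ →
    IsSol ν T u₀ u p → ∀ t ∈ Ico 0 T, (∫⁻ τ in Ioo 0 t, gradSup (u τ)) < ⊤ →
      hDotSq s (u t) ≤
        hDotSq s u₀ * ENNReal.ofReal (Real.exp (C * (∫⁻ τ in Ioo 0 t, gradSup (u τ)).toReal))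

/-- **Step 6′ — the Grönwall passage p.6 l.82–83** «Applying the classical Gronwall's inequality yields»:
(6.5) ⇒ (6.7), typed as the implication. TRUE-type. [claim: Sarici2026, status: under-review]
[cite: Sarici2026, p.6 l.82–95] -/
def Step_67_of (ν : ℝ) (s : ℕ) : Prop :=
  Step_65 ν s → Step_67 ν s

/-- **Step 7 — Theorem 6.1 (Global A Priori Bound), (6.4) p.6 l.49–59, AS PRINTED (conditional)**: «Let
u0 ∈ V ∩ H^s(ℝ³) for s ≥ 3. Under the spectral topological cutoff condition q > Jmax derived from Lemma
5.1, the solution satisfies: (6.4) sup_{t∈[0,T]} ‖u(t)‖²_{H^s} ≤ C(u0, ν), where C(u0, ν) is a strictly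
time-independent universal constant.» The condition «q > Jmax» is the leading binder; `q` occurs nowhere
else in the statement (it binds nothing: `step_Thm61_iff_unconditional`). Data instantiated on class (4);
«the solution» = every solution of the class from the datum on every `[0,T)`; `s` an integer (Thm 6.1:
`s ≥ 3`, imposed where consumed). [claim: Sarici2026, status: under-review]
[cite: Sarici2026, Thm 6.1 (6.4) p.6 l.49–59] -/
def Step_Thm61 (K : LPKit) (ν : ℝ) (s : ℕ) : Prop :=
  ∀ q : ℤ, K.Jmax < q →
    ∀ u₀ : E3 → E3, IsDatum u₀ → ∃ C : ℝ≥0,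
      ∀ (T : ℝ) (u : ℝ → E3 → E3) (p : ℝ → E3 → ℝ), IsSol ν T u₀ u p →
        ∀ t ∈ Ico 0 T, hSq s (u t) ≤ C

/-- **Step 7′ — the closing passage of the proof of Thm 6.1, p.6 l.92–96**: «≤ ‖u0‖²_{Ḣ^s} exp(CC∗). This
time-independent strict a priori bound guarantees that the H^s norms cannot blow up in finite time»:
(6.6) ∧ (6.7) ⇒ (6.4), typed as the implication (the lower-order part of the `H^s` norm is elided in
print as here). [claim: Sarici2026, status: under-review] [cite: Sarici2026, p.6 l.92–99; Thm 6.1 p.6 l.49–59] -/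
def Step_Thm61_of (K : LPKit) (ν : ℝ) (s : ℕ) : Prop :=
  Step_66 ν → Step_67 ν s → Step_Thm61 K ν s

/-! ## Kernel facts about the typed steps -/

/-- **«q > Jmax» binds nothing in (6.4)**: the conditional Theorem 6.1 as printed is equivalent to its
unconditional reading (instantiate `q := Jmax + 1`). [cite: Sarici2026, Thm 6.1 p.6 l.49–59] -/
theorem step_Thm61_iff_unconditional (K : LPKit) (ν : ℝ) (s : ℕ) :
    Step_Thm61 K ν s ↔
      ∀ u₀ : E3 → E3, IsDatum u₀ → ∃ C : ℝ≥0,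
        ∀ (T : ℝ) (u : ℝ → E3 → E3) (p : ℝ → E3 → ℝ), IsSol ν T u₀ u p →
          ∀ t ∈ Ico 0 T, hSq s (u t) ≤ C :=
  ⟨fun h => h (K.Jmax + 1) (by linarith), fun h _ _ => h⟩

/-- **(6.6) alone is Clay (A) at the print's viscosity** (the tree's Beale–Kato–Majda door
`clayR3_regularityAt_iff_aprioriBKM`; `|curl v| ≤ ‖curlCLM‖ ‖∇v‖` turns the `‖∇u‖_{L∞}` majorant into
BKM's vorticity majorant). [cite: Sarici2026, (6.6) p.6 l.71–82] [cite: BealeKatoMajda1984, Thm. 1]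
[cite: FeffermanClay2006, (A) p. 2] -/
theorem clayA_of_step66 {ν : ℝ} (hν : 0 < ν) (h : Step_66 ν) : clayR3.RegularityAt ν := by
  refine (clayR3_regularityAt_iff_aprioriBKM hν).2 ?_
  intro u₀ hu₀ hdiv hdec T u p hcl hu0 hE
  obtain ⟨Cstar, hC⟩ := h u₀ ⟨hu₀, hdiv, hdec⟩
  have hint : (∫⁻ t in Ioo 0 T, gradSup (u t)) ≤ Cstar := hC T u p ⟨hcl, hu0, hE⟩
  have hpt : ∀ t, (⨆ x, ‖curl (u t) x‖ₑ) ≤ ENNReal.ofReal ‖curlCLM‖ * gradSup (u t) := by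
    intro t
    refine iSup_le fun x => ?_
    calc ‖curl (u t) x‖ₑ ≤ ENNReal.ofReal ‖curlCLM‖ * ‖fderiv ℝ (u t) x‖ₑ := by
          rw [← ofReal_norm (curl (u t) x), ← ofReal_norm (fderiv ℝ (u t) x),
            ← ENNReal.ofReal_mul (norm_nonneg curlCLM)]
          exact ENNReal.ofReal_le_ofReal (norm_curl_le _ _)
      _ ≤ ENNReal.ofReal ‖curlCLM‖ * gradSup (u t) :=
          mul_le_mul' le_rfl (le_iSup (fun y => ‖fderiv ℝ (u t) y‖ₑ) x)
  calc (∫⁻ t in Ioo 0 T, ⨆ x, ‖curl (u t) x‖ₑ)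
      ≤ ∫⁻ t in Ioo 0 T, ENNReal.ofReal ‖curlCLM‖ * gradSup (u t) := lintegral_mono fun t => hpt t
    _ = ENNReal.ofReal ‖curlCLM‖ * ∫⁻ t in Ioo 0 T, gradSup (u t) :=
          lintegral_const_mul' _ _ ENNReal.ofReal_ne_top
    _ ≤ ENNReal.ofReal ‖curlCLM‖ * Cstar := mul_le_mul' le_rfl hint
    _ < ⊤ := ENNReal.mul_lt_top ENNReal.ofReal_lt_top ENNReal.coe_lt_top

/-- **The a priori `H^s` bound of Theorem 6.1 (`s ≥ 1`) gives the claimed global regularity** (p.6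
l.96–99 «the H^s norms cannot blow up in finite time. Consequently … globally regular»), by the tree's
`H¹` door `clayR3_regularityAt_iff_aprioriGradientL2Bound` (the `n = 1` term of the `H^s` norm bounds
`∫‖∇u(t)‖²` on `[0,T)`). [cite: Sarici2026, p.6 l.96–99; Thm 6.1 p.6 l.49–59]
[cite: FeffermanClay2006, (A) p. 2] -/
theorem claim_of_thm61 (K : LPKit) {ν : ℝ} {s : ℕ} (hν : 0 < ν) (hs : 1 ≤ s)
    (h : Step_Thm61 K ν s) : ClaimedTheorem ν := by
  have hA : clayR3.RegularityAt ν := by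
    refine (clayR3_regularityAt_iff_aprioriGradientL2Bound hν).2 ?_
    intro u₀ hu₀ hdiv hdec T u p hcl hu0 hE
    obtain ⟨C, hC⟩ := (step_Thm61_iff_unconditional K ν s).1 h u₀ ⟨hu₀, hdiv, hdec⟩
    refine ⟨C, fun t ht => ?_⟩
    have hb : hSq s (u t) ≤ C := hC T u p ⟨hcl, hu0, hE⟩ t ht
    have h1 : hDotSq 1 (u t) ≤ hSq s (u t) :=
      Finset.single_le_sum (f := fun n => hDotSq n (u t)) (fun _ _ => by positivity)
        (Finset.mem_range.2 (by omega))
    calc (∫⁻ x, ‖fderiv ℝ (u t) x‖ₑ ^ 2) = hDotSq 1 (u t) := by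
          refine lintegral_congr fun x => ?_
          rw [← ofReal_norm, ← norm_iteratedFDeriv_one, ofReal_norm]
      _ ≤ C := h1.trans hb
  intro u₀ hd
  exact hA u₀ hd.1 hd.2.1 hd.2.2

/-! ## Kernel composition and the Clay link -/

/-- **The printed chain composed in the kernel, every binder consumed** (Lemma 4.1 ∧ Lemma 5.1 ⟹[p.5
l.52–56] dominance above `Jmax` ⟹[p.6 l.71–75] (6.6); (6.5) ⟹[Grönwall] (6.7); (6.6) ∧ (6.7) ⟹ (6.4)
⟹ global regularity), for the print's `s ≥ 3` and `ν > 0`. [cite: Sarici2026, pp. 4–6; Thm 6.1 p.6 l.49–99] -/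
theorem claim_of_steps (K : LPKit) {ν : ℝ} {s : ℕ} (hν : 0 < ν) (hs : 3 ≤ s)
    (h41 : Step_L41 K) (h51 : Step_L51 K) (hdom : Step_dominance_of K ν) (h65 : Step_65 ν s)
    (h66 : Step_66_of K ν) (h67 : Step_67_of ν s) (h61 : Step_Thm61_of K ν s) :
    ClaimedTheorem ν :=
  claim_of_thm61 K hν (by omega) (h61 (h66 (hdom h41 h51)) (h67 h65))

/-- **CLAY LINK (PROVED, both ways)**: the claimed theorem at any fixed `ν > 0` IS Clay (A) — data (4)
exactly; one viscosity ⇔ all by the tree's scaling `clayR3_regularityAt_iff`. No «wrong problem» axis on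
the (A) side (the printed data class is wider, recorded). [cite: FeffermanClay2006, (A) with (4) (6) (7) p. 2]
[cite: Sarici2026, p.2 l.29–33; Thm 6.1 p.6 l.49–59] -/
theorem claimedTheorem_iff_clayA {ν : ℝ} (hν : 0 < ν) : ClaimedTheorem ν ↔ clayR3.Regularity := by
  rw [← clayR3_regularityAt_iff hν]
  constructor
  · intro h u₀ hu₀ hdiv hdec
    exact h u₀ ⟨hu₀, hdiv, hdec⟩
  · intro h u₀ hd
    exact h u₀ hd.1 hd.2.1 hd.2.2

/-- Clay (A) from the claimed theorem. [cite: FeffermanClay2006, (A) p. 2] -/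
theorem clay_of_claimed {ν : ℝ} (hν : 0 < ν) (h : ClaimedTheorem ν) : clayR3.Regularity :=
  (claimedTheorem_iff_clayA hν).1 h

/-- Clay (A) from (6.6) alone. [cite: Sarici2026, (6.6) p.6 l.71–82] [cite: FeffermanClay2006, (A) p. 2] -/
theorem clay_of_step66 {ν : ℝ} (hν : 0 < ν) (h : Step_66 ν) : clayR3.Regularity :=
  (clayR3_regularityAt_iff hν).1 (clayA_of_step66 hν h)

/-- Clay (A) from the printed chain. [cite: Sarici2026, pp. 4–6] [cite: FeffermanClay2006, (A) p. 2] -/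
theorem clay_of_steps (K : LPKit) {ν : ℝ} {s : ℕ} (hν : 0 < ν) (hs : 3 ≤ s)
    (h41 : Step_L41 K) (h51 : Step_L51 K) (hdom : Step_dominance_of K ν) (h65 : Step_65 ν s)
    (h66 : Step_66_of K ν) (h67 : Step_67_of ν s) (h61 : Step_Thm61_of K ν s) :
    clayR3.Regularity :=
  clay_of_claimed hν (claim_of_steps K hν hs h41 h51 hdom h65 h66 h67 h61)

/-! ## Rev 2 (ADDITIVE — nothing above is touched): the Grönwall passage with its printed-implicit
regularity clauses (SALVAGE pen ns-claims-salvage-p3 g5 OFFER 2026-08-27T15:49:38Z) -/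

/-- **Step 6″ — the Grönwall passage p.6 l.82–83 with the regularity the classical Grönwall lemma uses
made explicit** (all implicit in print for «the solution»: `t ↦ ‖u(t)‖²_{Ḣ^s}` finite and continuous on
`[0,T)`, `t ↦ ‖∇u(t)‖_{L∞}` finite and continuous on `[0,T)`): (6.5) ⇒ (6.7) on every solution of the
class carrying these clauses. WEAKER than `Step_67_of` (more hypotheses); TRUE-type — the face the
SALVAGE pen discharges Summits-side. [claim: Sarici2026, status: under-review]
[cite: Sarici2026, (6.5) p.6 l.60–70; (6.7) p.6 l.82–95] -/
def Step_67_of_cont (ν : ℝ) (s : ℕ) : Prop :=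
  Step_65 ν s →
    ∃ C : ℝ≥0, ∀ (u₀ : E3 → E3) (T : ℝ) (u : ℝ → E3 → E3) (p : ℝ → E3 → ℝ), IsDatum u₀ →
      IsSol ν T u₀ u p →
      (∀ τ ∈ Ico 0 T, hDotSq s (u τ) < ⊤) →
      ContinuousOn (fun τ => (hDotSq s (u τ)).toReal) (Ico 0 T) →
      (∀ τ ∈ Ico 0 T, gradSup (u τ) < ⊤) →
      ContinuousOn (fun τ => (gradSup (u τ)).toReal) (Ico 0 T) →
        ∀ t ∈ Ico 0 T, (∫⁻ τ in Ioo 0 t, gradSup (u τ)) < ⊤ →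
          hDotSq s (u t) ≤
            hDotSq s u₀ * ENNReal.ofReal (Real.exp (C * (∫⁻ τ in Ioo 0 t, gradSup (u τ)).toReal))

/-- `Step_67_of` implies its clause-carrying face (the clauses are only ever hypotheses).
[cite: Sarici2026, p.6 l.82–95] -/
theorem step_67_of_cont_of_step_67_of {ν : ℝ} {s : ℕ} (h : Step_67_of ν s) : Step_67_of_cont ν s := by
  intro h65
  obtain ⟨C, hC⟩ := h h65
  exact ⟨C, fun u₀ T u p hd hs _ _ _ _ t ht hfin => hC u₀ T u p hd hs t ht hfin⟩

end

end Literature.Claims.NS.Sarici2026
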